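/-
Copyright (c) 2026. All rights reserved.
Released under Apache 2.0 license as described in the file LICENSE.
Authors: abc-iut cell, seat abc-iut-L4-t10 (gen 3; interface author of `AutHolFieldFunctor`; node
`AbsTopIII:Cor4.5` — the residual hypothesis of the GEOMETRIC model discharged at the complex plane).
-/
import Literature.AnabelianGeometry.AbsoluteAnabelian.ArchimedeanHolFieldFunctorGeometric
import Mathlib.Geometry.Manifold.MFDeriv.FDeriv
import HarnessLib

/-!
# [AbsTopIII] Prop 4.2 (i) / Cor 4.5 at the holomorphic geometric model: `EA` restricted to the complex
# plane IS id-rigid (proved), so Cor 4.5 (i)–(v) hold there outright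

S. Mochizuki, *Topics in absolute anabelian geometry III*, Prop 4.2 (i) p. 105 ("In particular, the
categories `EA`, `𝒞^hol_T = 𝒞̲^hol_T` … are id-rigid"), its proof p. 106, and Cor 4.5 (i)–(v) pp. 107–110
of the author's kurims manuscript (lit key `paper:url-5493eb38cbb7`, read on the page; bib key
`MochizukiAbsTopIII2015`).  PROOF-ONLY companion (abc-iut cell, node `AbsTopIII:Cor4.5`; no declaration of a
notion) of abc-iut-L4-t14's `ArchimedeanHolFieldFunctorGeometric.lean`, which instantiates the Cor 2.7 (e)
+ functoriality interface `AutHolFieldFunctor` (abc-iut-L4-t10) on GEOMETRIC carriers — connected Riemann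
surfaces with holomorphic finite étale maps, `EA^hol_RS(Q)` the full subcategory cut out by an object
property `Q`, `𝒜_𝕏 = ℂ`, `𝒜_φ = id` — and specialises the model theorems of Cor 4.5 / Prop 4.2 (i) to
them, leaving ONE hypothesis: `hE : IsIdRigid EA^hol_RS(Q)` (print: "follows immediately from the slimness
assertion of Lemma 4.3"; for general `Q` campaign-L).

Here that hypothesis is PROVED at the simplest geometric object property, `Q = (· = complexPlane)`:

* `HolRS.exists_hom_plane_affine` — every affine map `z ↦ a·z + b`, `a ≠ 0`, IS a morphism `ℂ ⟶ ℂ` of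
  `HolRS` (holomorphic: `Differentiable.mdifferentiable`; finite étale: a homeomorphism,
  abc-iut-L4-t2's `IsFiniteEtale.of_homeomorph`);
* `HolRS.isIdRigid_EA_plane` — **`EA^hol_RS(· = complexPlane)` is id-rigid**: the component at `ℂ` of an
  automorphism `α` of the identity functor is a holomorphic finite étale `g : ℂ → ℂ` commuting (naturality)
  with every morphism `ℂ ⟶ ℂ`; commuting with the translations gives `g = (· + c)`, commuting with the
  dilation `z ↦ 2z` gives `c = 0`.  No classification of the finite étale self-maps of `ℂ` is used: the
  AUTOMORPHISMS already rigidify (contrast: abc-iut-w5-d226's punctured-plane witness p421760, where the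
  non-invertible `z ↦ z²` rigidifies, and the Galois-category instance p421893, where slimness does —
  the printed route);
* `HolRS.exists_hom_plane_ne_id` — the rigidity is not for want of morphisms: `EA^hol_RS(· = complexPlane)`
  has non-identity (auto)morphisms;
* `HolRS.isIdRigid_pairs_plane`, **`HolRS.cor_4_5_geometric_plane`** — hence Prop 4.2 (i)'s id-rigidity of
  `𝒞^hol_TF`, `𝒞^hol_T` (`T ∈ {TM, TLG, TCG}`) and Cor 4.5 (i)–(v) AS TYPED (`Cor_4_5 =
  LogFrobeniusCompatible`) hold OUTRIGHT for the archimedean log-Frobenius data built over the geometric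
  carrier `ℂ` — abc-iut-L4-t14's `isIdRigid_pairs_of_isIdRigid_EA` / `cor_4_5_geometric` with their
  hypothesis discharged.

HONEST SCOPE: the complex plane is the universal covering of every elliptic curve, NOT an elliptically
admissible hyperbolic orbicurve (print's `EA`); for hyperbolic `Q` the id-rigidity is Lemma 4.3's slimness
via Cor 2.3 (i) and Riemann existence (campaign-L), not treated here.  Refereed pre-IUT anabelian geometry;
nothing here bears on [IUTchIII] Cor. 3.12 or takes a side; model ≠ reconstruction.
-/

set_option autoImplicit false

noncomputable section

namespace Literature.AnabelianGeometry.AbsoluteAnabelian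

open _root_.CategoryTheory _root_.Topology
open scoped _root_.Manifold _root_.ContDiff

namespace HolRS

/-! ### Affine maps are morphisms of the complex plane -/

/-- **Every affine map `z ↦ a·z + b` (`a ≠ 0`) is a holomorphic finite étale self-map of the complex
plane**, i.e. a morphism `complexPlane ⟶ complexPlane` of `HolRS` (holomorphic; a self-homeomorphism, hence
finite étale). [cite: MochizukiAbsTopIII2015, Definition 4.1 (iii) p.103] -/
theorem exists_hom_plane_affine (a : ℂ) (ha : a ≠ 0) (b : ℂ) :
    ∃ f : complexPlane ⟶ complexPlane, ∀ z : ℂ, f.toFun z = a * z + b := by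
  -- the homeomorphism `z ↦ a z + b`
  let e : ℂ ≃ₜ ℂ := (Homeomorph.mulLeft₀ a ha).trans (Homeomorph.addRight b)
  have he : (⇑e : ℂ → ℂ) = fun z => a * z + b := by
    funext z
    simp [e]
  have hmd : MDifferentiable 𝓘(ℂ, ℂ) 𝓘(ℂ, ℂ) (fun z : ℂ => a * z + b) :=
    (mdifferentiable_iff_differentiable (f := fun z : ℂ => a * z + b)).mpr (by fun_prop)
  have hfe : IsFiniteEtale (fun z : ℂ => a * z + b) := by
    rw [← he]
    exact IsFiniteEtale.of_homeomorph e
  exact ⟨⟨fun z : ℂ => a * z + b, hmd, hfe⟩, fun z => rfl⟩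

/-- `EA^hol_RS(· = complexPlane)` has NON-identity morphisms (e.g. the translation `z ↦ z + 1`): its
id-rigidity below is not vacuous rigidity. [cite: MochizukiAbsTopIII2015, Proposition 4.2 (i) p.105] -/
theorem exists_hom_plane_ne_id :
    ∃ (X : (geometricAutHolFieldFunctor (fun X : HolRS => X = complexPlane)).EA) (f : X ⟶ X), f ≠ 𝟙 X := by
  obtain ⟨t, ht⟩ := exists_hom_plane_affine 1 one_ne_zero 1
  refine ⟨⟨complexPlane, rfl⟩, InducedCategory.homMk t, fun h => ?_⟩
  -- evaluate the underlying maps at `0`: `1 = 0`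
  have h0 : (InducedCategory.homMk t : (⟨complexPlane, rfl⟩ :
      (geometricAutHolFieldFunctor (fun X : HolRS => X = complexPlane)).EA) ⟶ ⟨complexPlane, rfl⟩).hom.toFun
        (0 : ℂ) = (0 : ℂ) := by
    rw [h]
    rfl
  have h1 : (1 : ℂ) * 0 + 1 = 0 := by
    rw [← ht 0]
    exact h0
  norm_num at h1

/-! ### Id-rigidity of `EA` over the complex plane -/

/-- **Prop 4.2 (i) ("the categor[y] `EA` … [is] id-rigid") at the holomorphic geometric model over the
complex plane — PROVED**: every automorphism of the identity functor of `EA^hol_RS(· = complexPlane)` is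
the identity.  Its component at `ℂ` is a morphism `g` with `g ∘ f = f ∘ g` for all morphisms `f : ℂ ⟶ ℂ`;
`f = (· + b)` gives `g z = z + g 0`, `f = (2 · )` gives `g 0 = 0`.
[cite: MochizukiAbsTopIII2015, Proposition 4.2 (i) p.105] -/
theorem isIdRigid_EA_plane :
    IsIdRigid (geometricAutHolFieldFunctor (fun X : HolRS => X = complexPlane)).EA := by
  refine isRigidFunctor_of_hom_app_eq_id fun α P => ?_
  obtain ⟨X, hX⟩ := P
  subst hX
  -- the component of `α` at `ℂ`, as a self-map of `ℂ`
  let g : ℂ → ℂ := fun z => (α.hom.app ⟨complexPlane, rfl⟩).hom.toFun z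
  -- naturality of `α.hom` along a morphism `f : ℂ ⟶ ℂ`, pointwise
  have hnat : ∀ (f : complexPlane ⟶ complexPlane) (z : ℂ), g (f.toFun z) = f.toFun (g z) := by
    intro f z
    have h := α.hom.naturality (X := ⟨complexPlane, rfl⟩) (Y := ⟨complexPlane, rfl⟩)
      (InducedCategory.homMk f)
    exact congrArg (fun k => Hom.toFun (InducedCategory.Hom.hom k) z) h
  -- translations: `g (z + b) = g z + b`
  have htr : ∀ b z : ℂ, g (z + b) = g z + b := by
    intro b z
    obtain ⟨t, ht⟩ := exists_hom_plane_affine 1 one_ne_zero b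
    have h := hnat t z
    rw [ht, ht, one_mul, one_mul] at h
    exact h
  have hc : ∀ z : ℂ, g z = z + g 0 := by
    intro z
    have h := htr z 0
    rwa [zero_add, add_comm (g 0)] at h
  -- the dilation by `2`: `g 0 = 0`
  have h0 : g 0 = 0 := by
    obtain ⟨d, hd⟩ := exists_hom_plane_affine 2 two_ne_zero 0
    have h := hnat d 0
    rw [hd, hd, add_zero, add_zero, mul_zero] at h
    -- `h : g 0 = 2 * g 0`
    linear_combination -h
  -- conclude
  apply InducedCategory.hom_ext
  apply hom_ext
  funext z
  change g z = z
  rw [hc z, h0, add_zero]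

/-! ### Consequences: Prop 4.2 (i) for the pairs and Cor 4.5, unconditionally over the plane -/

/-- **Prop 4.2 (i), id-rigidity of `𝒞^hol_TF` and `𝒞^hol_T` (`T ∈ {TM, TLG, TCG}`), OUTRIGHT over the
complex plane** (abc-iut-L4-t14's `isIdRigid_pairs_of_isIdRigid_EA` with its hypothesis discharged).
[cite: MochizukiAbsTopIII2015, Proposition 4.2 (i) p.105] -/
theorem isIdRigid_pairs_plane {T : ArchPairType} (hT : T.IsMonoidType) :
    IsIdRigid (HolTFPair (geometricAutHolFieldFunctor (fun X : HolRS => X = complexPlane))) ∧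
      IsIdRigid (HolMonoidPair (geometricAutHolFieldFunctor (fun X : HolRS => X = complexPlane)) T) :=
  isIdRigid_pairs_of_isIdRigid_EA _ isIdRigid_EA_plane hT

/-- **[AbsTopIII] Cor 4.5 (i)–(v) AS TYPED hold OUTRIGHT for the archimedean log-Frobenius data over the
geometric carrier `ℂ`**: abc-iut-L4-t14's `cor_4_5_geometric` (= abc-iut-L4-t10's `cor_4_5_arch` at the
geometric instance) with both inputs supplied — the object `ℂ` and `isIdRigid_EA_plane`.
[cite: MochizukiAbsTopIII2015, Corollary 4.5 pp.107–109] -/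
theorem cor_4_5_geometric_plane :
    Literature.AnabelianGeometry.AbsoluteAnabelian.AbsTopIII.Cor_4_5
      (archLogFrobeniusData (geometricAutHolFieldFunctor (fun X : HolRS => X = complexPlane)))
      (archTelecoreData (geometricAutHolFieldFunctor (fun X : HolRS => X = complexPlane))) :=
  cor_4_5_geometric _ ⟨complexPlane, rfl⟩ isIdRigid_EA_plane

/-- The five printed items separately, over the plane. [cite: MochizukiAbsTopIII2015, Corollary 4.5 pp.107–109] -/
theorem cor_4_5_geometric_plane_items :
    AbsTopIII.Cor_4_5_i
        (archLogFrobeniusData (geometricAutHolFieldFunctor (fun X : HolRS => X = complexPlane))) ∧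
      AbsTopIII.Cor_4_5_ii
        (archLogFrobeniusData (geometricAutHolFieldFunctor (fun X : HolRS => X = complexPlane)))
        (archTelecoreData (geometricAutHolFieldFunctor (fun X : HolRS => X = complexPlane))) ∧
      AbsTopIII.Cor_4_5_iii
        (archLogFrobeniusData (geometricAutHolFieldFunctor (fun X : HolRS => X = complexPlane))) ∧
      AbsTopIII.Cor_4_5_iv
        (archLogFrobeniusData (geometricAutHolFieldFunctor (fun X : HolRS => X = complexPlane)))
        (archTelecoreData (geometricAutHolFieldFunctor (fun X : HolRS => X = complexPlane))) ∧
      AbsTopIII.Cor_4_5_v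
        (archLogFrobeniusData (geometricAutHolFieldFunctor (fun X : HolRS => X = complexPlane))) :=
  (AbsTopIII.cor_4_5_iff _ _).mp cor_4_5_geometric_plane

end HolRS

end Literature.AnabelianGeometry.AbsoluteAnabelian

end
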